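import Summits.BirchSwinnertonDyer.BirchSwinnertonDyer.Theorems.ManinLocalTwoThreeStevensInfinityFibreRationalAnyConstant
import Summits.BirchSwinnertonDyer.BirchSwinnertonDyer.Theorems.ManinLocalTwoThreeFlatGamma1Datum
import HarnessLib

/-!
# E-es-207 `ShimuraKernelRational` (THEOREM K, constancy half) for EVERY `X₀(N)`-datum — PROVED, and CES♭ lattice-clause-free
(route `ManinLocalTwoThree`, crux C2 stmt-BirchSwinnertonDyer-22967; cell bsd-f2-manin, prover p2 gen 23; es g41d §9/§10 rows)

For every `X₀(N)`-datum `D₀` of an elliptic `W₀/ℚ` there are an elliptic `W₁/ℚ` and an `X₁(N)`-datum `D₁` of `W₁` with the same newform whose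
Néron lattice IS `Λ₁(f)`, such that every `Γ₀(N)`-period `z ∈ Λ₀(f)` uniformises to a RATIONAL point of `W₁` — es g41d's E-es-207
`ShimuraKernelRational` VERBATIM (`shimuraKernelRational`), with no lattice clause and no printed fact: restrict `D₀` to an `X₁(N)`-datum of `W₀`
(`FlatGamma1Datum.exists_gamma1ParametrizationData_of_datum`), take its Stevens twin (`CuspValues.exists_stevensTwin`, p767395: `c = 1`, optimal,
`Λ(D₁.L) = Λ₁(f)`), and apply the `∞`-fibre rationality `CuspValues.exists_ratPoint_eq_uniformize_of_mem_periodLattice` (p767254).  The same twin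
gives CES♭ for an ARBITRARY `X₀(N)`-datum (`exists_optimal_gamma1ParametrizationData_flat_of_datum`; p3's `StevensCurve.exists_optimal_gamma1ParametrizationData_flat`
assumed the lattice clause; es g41d `exists_stevensCurve_flat`).  With es's kernel-checked glue (`primeLevelShimuraExponentLeThree_of_rational`,
HOME/es/g41/Sketch-es-g41d.lean §9) the prime-level rung of the Derickx–Orlić question rests on the Miyawaki–Setzer torsion fact E-es-208 alone.

HONEST FRAMING: unconditional and fact-free; nothing about C2/C3, Manin's conjecture or BSD is proved here.  No definitions, no sorry.
[cite: Stevens1982, §1.3 Thm. 1.3.1] [cite: Stevens1989, §2 (1.4), (2.8)] [cite: ConradEdixhovenStein2003, §6.1] [cite: Manin1972, Thm. 1.9]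
-/

set_option autoImplicit false
-- lint-debt: the directory name repeats the summit name (sibling precedent `ManinLocalTwoThreeStevensInfinityFibreRational.lean`)
set_option linter.dupNamespace false

noncomputable section

open scoped MatrixGroups ModularForm PeriodPair
open Complex Function CongruenceSubgroup WeierstrassCurve
open UpperHalfPlane hiding I
open Literature.NumberTheory.EllipticCurves Literature.NumberTheory.EllipticCurves.ModularForms

namespace Summit.BirchSwinnertonDyer.BirchSwinnertonDyer.Theorems.ManinLocalTwoThree.CuspValues

variable {N : ℕ} [NeZero N]

/-- **The Stevens twin of an `X₀(N)`-datum, lattice-clause-free (CES♭ for an ARBITRARY datum)**: for every `X₀(N)`-datum `D₀` of an elliptic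
`W₀/ℚ` there are an elliptic `W₁/ℚ`, `ℚ`-isogenous to `W₀`, and an OPTIMAL `X₁(N)`-datum `D₁` of `W₁` with `D₁.f = D₀.f`, `D₁.c = 1`,
`Λ(D₁.L) = Λ₁(f)` (p3's `StevensCurve.exists_optimal_gamma1ParametrizationData_one` without its lattice clause).
[cite: Stevens1989, §2] [cite: ConradEdixhovenStein2003, §6.1] [cite: SilvermanAEC2009, Thm. VI.4.1] -/
theorem exists_optimal_gamma1ParametrizationData_flat_of_datum {W₀ : WeierstrassCurve ℚ} [W₀.IsElliptic] (D₀ : ModularParametrizationData W₀ N) :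
    ∃ (W₁ : WeierstrassCurve ℚ) (_ : W₁.IsElliptic) (D₁ : Gamma1ParametrizationData W₁ N),
      D₁.f = D₀.f ∧ D₁.c = 1 ∧ D₁.IsOptimal ∧ (∀ x, x ∈ D₁.L.lattice ↔ x ∈ periodLatticeGamma1 D₀.f) ∧ WeierstrassCurve.IsIsogenous W₁ W₀ := by
  haveI : Algebra.IsAlgebraic ℚ (AlgebraicClosure ℚ) := AlgebraicClosure.isAlgebraic ℚ
  haveI : IsAlgClosure ℚ (AlgebraicClosure ℚ) := AlgebraicClosure.instIsAlgClosure ℚ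
  letI : Algebra (AlgebraicClosure ℚ) ℂ := (IsAlgClosed.lift : AlgebraicClosure ℚ →ₐ[ℚ] ℂ).toRingHom.toAlgebra
  haveI : IsScalarTower ℚ (AlgebraicClosure ℚ) ℂ := IsScalarTower.of_algebraMap_eq' (Subsingleton.elim _ _)
  obtain ⟨D, hf, -, -, -⟩ := FlatGamma1Datum.exists_gamma1ParametrizationData_of_datum D₀
  obtain ⟨W₁, hW₁, D₁, hf₁, hc₁, hopt₁, hL, ψ, -⟩ := exists_stevensTwin D
  refine ⟨W₁, hW₁, D₁, hf₁.trans hf, hc₁, hopt₁, fun x ↦ ?_, ⟨ψ⟩⟩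
  rw [hL x, hf]

/-- **E-es-207 `ShimuraKernelRational` (es g41d, HOME/es/g41/Sketch-es-g41d.lean §9), VERBATIM, PROVED** — THEOREM K, constancy half: for every
`X₀(N)`-datum `D₀` of an elliptic `W₀/ℚ` there is an elliptic `W₁/ℚ` with an `X₁(N)`-datum `D₁` of the same newform whose Néron lattice IS
`Λ₁(f)`, such that every `Γ₀(N)`-period `z ∈ Λ₀(f)` uniformises to a RATIONAL point of `W₁`.
[cite: Stevens1982, §1.3 Thm. 1.3.1] [cite: Stevens1989, §2 (1.4), (2.8)] [cite: Manin1972, Thm. 1.9] -/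
theorem shimuraKernelRational :
    ∀ (W₀ : WeierstrassCurve ℚ) [W₀.IsElliptic] {N : ℕ} [NeZero N] (D₀ : ModularParametrizationData W₀ N),
      ∃ (W₁ : WeierstrassCurve ℚ) (_ : W₁.IsElliptic) (D₁ : Gamma1ParametrizationData W₁ N),
        D₁.f = D₀.f ∧ (∀ x, x ∈ D₁.L.lattice ↔ x ∈ periodLatticeGamma1 D₀.f) ∧
        ∀ z ∈ periodLattice D₀.f, ∃ P : (W₁.baseChange ℚ).toAffine.Point,
          WeierstrassCurve.Affine.Point.baseChange (W' := W₁) ℚ ℂ P = D₁.uniformize z := by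
  intro W₀ _ N _ D₀
  obtain ⟨W₁, hW₁, D₁, hf, hc₁, -, hL, -⟩ := exists_optimal_gamma1ParametrizationData_flat_of_datum D₀
  haveI := hW₁
  refine ⟨W₁, hW₁, D₁, hf, hL, fun z hz ↦ ?_⟩
  exact exists_ratPoint_eq_uniformize_of_mem_periodLattice D₁ hc₁ z (by rwa [hf])

end Summit.BirchSwinnertonDyer.BirchSwinnertonDyer.Theorems.ManinLocalTwoThree.CuspValues

end
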